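import Mathlib
import HarnessLib
import Summits.ValiantsHypothesis.ValiantsHypothesis.Theses.MonotoneRestoration
import Literature.Computability.AlgebraicComplexity.ArithCircuit
import Literature.Computability.AlgebraicComplexity.ArithCircuitProofs
import Literature.Computability.AlgebraicComplexity.MonotoneStructure
import Literature.Computability.AlgebraicComplexity.PermanentIrreducible
import Literature.ModelTheory.FiniteModelTheory.CkEquiv
import Summits.ValiantsHypothesis.ValiantsHypothesis.Theorems.MonotoneRestorationMonotoneRestorationQPCosetCount
import Summits.ValiantsHypothesis.ValiantsHypothesis.Theorems.MonotoneRestorationMonotoneRestorationQPSymmetricLB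
import Summits.ValiantsHypothesis.ValiantsHypothesis.Theorems.MonotoneRestorationMonotoneRestorationQPSupportSymmetrisation
import Summits.ValiantsHypothesis.ValiantsHypothesis.Theorems.MonotoneRestorationMonotoneRestorationQPSparseRegime
import Summits.ValiantsHypothesis.ValiantsHypothesis.Theorems.MonotoneRestorationMonotoneRestorationQPBeta
import Literature.Computability.AlgebraicComplexity.SymmetricArithCircuit
import Literature.Computability.AlgebraicComplexity.DawarWilsenach2025Proofs
import Literature.GroupTheory.PermutationGroups.SmallIndexSubgroups
import Summits.ValiantsHypothesis.ValiantsHypothesis.Theorems.MonotoneRestorationQP.Negative.LoadBearing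
import Summits.ValiantsHypothesis.ValiantsHypothesis.Theorems.MonotoneRestorationMonotoneRestorationQPPermSupportCount

/-! TTRL-lite variant V19914 of stmt-ValiantsHypothesis-15886

Target `stub_mulGate_children_extend` (slug `valian15886-stub-mulgate-children-`), move `small_case`
(boundary probe): conjunct (2) of the stub — "monomials of two DISTINCT children multiply into a
monomial extendable into `f`" — transplanted from a `×`-gate to a `+`-gate, on the smallest gate
type `G = Fin 3` over one variable (`n = 1`).  It is FALSE: the label `mul` is load-bearing for (2).
-/

-- `Summit.ValiantsHypothesis.ValiantsHypothesis.…` is the tree's mandated single-conjunct layout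
-- (Sub = Summit), so the duplicated namespace component is intended.
set_option linter.dupNamespace false

namespace Summit.ValiantsHypothesis.ValiantsHypothesis.Theorems

open Summit.ValiantsHypothesis.ValiantsHypothesis.Theses.MonotoneRestoration
open Literature.Computability.AlgebraicComplexity

/-- **TTRL-lite variant V19914 of `stub_mulGate_children_extend` is FALSE** (conjunct (2) at an
ADDITION gate, `G = Fin 3`, `n = 1`).  Witness: the three-gate circuit on the single variable
`v = (0,0)` with `g₀ = var v` (computing `X v`), `g₁ = ×{g₀}` (computing `X v`) and the output
`P = g₂ = +{g₀, g₁}` (computing `X v + X v ≠ 0`, whose support `{v¹}` extends into that of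
`f = X v` with `μ = 0`); for the distinct children `h = g₀`, `h' = g₁` and their monomials
`m = m' = v¹`, every `m + m' + μ` has exponent `≥ 2` at `v`, while the unique monomial of `f` has
exponent `1`.  So for a `+`-gate only the per-child inclusion (conjunct (1)) survives; the
cross-term conclusion needs the label `mul`. [cite: DawarWilsenach2025, Def. 2.2] -/
theorem stub_mulGate_children_extend_var19914_false :
    ¬ (∀ (C : LabelledArithCircuit NNReal (Fin 1 × Fin 1) Unit (Fin 3))
        (f : MvPolynomial (Fin 1 × Fin 1) NNReal) (P : Fin 3), C.label P = .add → C.eval P ≠ 0 →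
        (∃ μ : (Fin 1 × Fin 1) →₀ ℕ, ∀ m ∈ (C.eval P).support, m + μ ∈ f.support) →
        ∀ h ∈ C.children P, ∀ h' ∈ C.children P, h ≠ h' →
          ∀ m ∈ (C.eval h).support, ∀ m' ∈ (C.eval h').support,
            ∃ μ : (Fin 1 × Fin 1) →₀ ℕ, m + m' + μ ∈ f.support) := by
  classical
  intro h
  -- The witness circuit on `Fin 3`, packaged with the six equations describing it.
  obtain ⟨C, hl0, hl1, hl2, hc0, hc1, hc2⟩ :
      ∃ C : LabelledArithCircuit NNReal (Fin 1 × Fin 1) Unit (Fin 3),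
        C.label 0 = .var ((0 : Fin 1), (0 : Fin 1)) ∧ C.label 1 = .mul ∧ C.label 2 = .add ∧
        C.children 0 = ∅ ∧ C.children 1 = {0} ∧ C.children 2 = {0, 1} := by
    refine ⟨{ children := ![∅, {0}, {0, 1}]
              label := ![.var ((0 : Fin 1), (0 : Fin 1)), .mul, .add]
              output := fun _ => 2
              wf := ?_
              isInput_iff := ?_
              eq_of_label_eq := ?_
              output_injective := fun _ _ _ => Subsingleton.elim _ _ },
      rfl, rfl, rfl, rfl, rfl, rfl⟩
    · -- acyclicity: every wire goes from a smaller to a larger gate index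
      refine Subrelation.wf (r := (· < ·)) ?_ wellFounded_lt
      intro a b hab
      revert a b
      decide
    · intro g
      fin_cases g <;> simp
    · intro g g' hg hl
      fin_cases g <;> fin_cases g' <;> simp_all
  -- The three gate polynomials.
  have he0 : C.eval 0 = MvPolynomial.X ((0 : Fin 1), (0 : Fin 1)) := C.eval_of_label_var hl0
  have he1 : C.eval 1 = MvPolynomial.X ((0 : Fin 1), (0 : Fin 1)) := by
    rw [C.eval_of_label_mul hl1, hc1, Finset.prod_singleton, he0]
  have he2 : C.eval 2 = MvPolynomial.X ((0 : Fin 1), (0 : Fin 1)) +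
      MvPolynomial.X ((0 : Fin 1), (0 : Fin 1)) := by
    rw [C.eval_of_label_add hl2, hc2, Finset.sum_pair (by decide), he0, he1]
  have hX : (Finsupp.single ((0 : Fin 1), (0 : Fin 1)) 1 : Fin 1 × Fin 1 →₀ ℕ) ∈
      (MvPolynomial.X ((0 : Fin 1), (0 : Fin 1)) : MvPolynomial (Fin 1 × Fin 1) NNReal).support := by
    rw [MvPolynomial.support_X]
    exact Finset.mem_singleton_self _
  have hne : C.eval 2 ≠ 0 := by
    rw [he2]
    intro h0
    have h1 := congrArg
      (MvPolynomial.coeff (Finsupp.single ((0 : Fin 1), (0 : Fin 1)) 1)) h0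
    simp only [MvPolynomial.coeff_add, MvPolynomial.coeff_X, MvPolynomial.coeff_zero] at h1
    norm_num at h1
  have hext : ∃ μ : (Fin 1 × Fin 1) →₀ ℕ, ∀ m ∈ (C.eval 2).support,
      m + μ ∈ (MvPolynomial.X ((0 : Fin 1), (0 : Fin 1)) :
        MvPolynomial (Fin 1 × Fin 1) NNReal).support := by
    refine ⟨0, fun m hm => ?_⟩
    rw [add_zero]
    rw [he2] at hm
    rcases Finset.mem_union.1 (MvPolynomial.support_add hm) with hm' | hm'
    · exact hm'
    · exact hm'
  have hm0 : (0 : Fin 3) ∈ C.children 2 := by rw [hc2]; simp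
  have hm1 : (1 : Fin 3) ∈ C.children 2 := by rw [hc2]; simp
  obtain ⟨μ, hμ⟩ := h C (MvPolynomial.X ((0 : Fin 1), (0 : Fin 1))) 2 hl2 hne hext 0 hm0 1 hm1
    (by decide) _ (he0 ▸ hX) _ (he1 ▸ hX)
  rw [MvPolynomial.support_X, Finset.mem_singleton] at hμ
  have h2 := congrArg (fun g : Fin 1 × Fin 1 →₀ ℕ => g ((0 : Fin 1), (0 : Fin 1))) hμ
  simp only [Finsupp.add_apply, Finsupp.single_eq_same] at h2
  omega

end Summit.ValiantsHypothesis.ValiantsHypothesis.Theorems
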